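import Literature.NumberTheory.EllipticCurves.BurungaleSkinnerTianWan2024.CyclotomicMainStatementRankOneBSDOPEN
import Literature.NumberTheory.EllipticCurves.HeegnerModuleIndex
import HarnessLib

/-!
# Burungale–Skinner–Tian–Wan (arXiv:2409.01350v2, PREPRINT), §12.2 "`p`-converse and Heegner main
# conj." for an elliptic curve at an ORDINARY prime: Prop. 12.7 (Kato's main conj. for `g`, `g ⊗ χ_L`
# + the Howard-type divisibility ⟹ Perrin-Riou's Heegner main conj.), Thm. 12.9 (the Heegner main conj.
# under (irr_ℚ), (ram), (sur)) and Prop. 12.10 (⟹ the `p`-converse over `L`) — explicitly labelled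
# OPEN binders (claim-tagged; NEVER facts) in the tree's Heegner-module currency

Written by the typer seat `bsd-littype-01` (gen 2) of the cross-ladder literature-typing layer
(D-0088(4); cell `run/shared/lean/pub/bsd-littype/`). D-0064: one file for §12.2 of the source.
HONEST FRAMING: UNREFEREED preprint ⇒ explicitly labelled OPEN hypotheses only (`def … : Prop`,
`[claim: …, status: under-review]`), NEVER theorems, NEVER `[cite:]`-facts; nothing asserted about any
curve; nothing booked; no `_holds`. The Heegner main conj. (statement 9.15 of the source, label `HMC`,
Perrin-Riou 1987) is written in EXACTLY the tree's published currency for it —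
`Literature/NumberTheory/EllipticCurves/HeegnerModuleIndex.lean` (`LambdaAdicSelmerData` = `𝔖 =
lim← lim← Sel_{p^m}(E/K_n)`, `SelmerDualData` = `X = Sel_{p^∞}(E/K_∞)^∨` over the ANTICYCLOTOMIC
`ℤ_p`-extension `κ` of `K`, `HeegnerFamily`, `heegnerCharIdeal D F = char_Λ(𝔖/𝐇)`) — i.e. the
shape of the tree facts `Howard2004_thmB` (divisibility), `BurungaleCastellaKim2021.thm31_…`
(divisibility, irreducible image) and `CastellaGrossiSkinner2025.thmC_…` (equality, Eisenstein `p`);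
the two cyclotomic main-conj. hypotheses are the predicate `CharIdealEqPadicLFunctionNeron` of the
sibling file `CyclotomicMainStatementRankOneBSDOPEN.lean` (statement 9.3 (b) ≡ 9.6 (b) at an
ordinary `p ∤ N`, Lemma 9.16 (i); Néron normalisation; reading flag `BSTW-1111-lattice` there).

## Printed statements (arXiv:2409.01350v2, pp. 97–98; litref page file `…/bstw24-v2-pages.json`)

* **Prop. 12.7** (label `HMC-prop`, tex l.8214): "Let `g ∈ S₂(Γ₀(N))` be a non-CM elliptic newform
  … Let `p ∤ 2N` be a prime, `λ` a prime of the Hecke field `F` above `p` and `T` the `λ`-adic Tate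
  module of `A_g`. Suppose that • `λ ∤ a_p(g)`, • the `λ`-adic Galois representation `ρ` satisfies
  (van_ℚ). Let `L` be an imaginary quadratic field satisfying (ord), (coprime), (Heeg) and (van_L) such
  that (HMC_ub) `ξ_{Λ^ac}(X(g)_tor) ∣ ξ_{Λ^ac}(H¹_ord(L, T_g ⊗ Λ^ac)/Λ^ac·κ_g) · ξ_{Λ^ac}(H¹_ord(L, T_g ⊗
  Λ^ac)/Λ^ac·κ_g^ι)`. Then the `λ`-adic Kato's main Conj[.] 9.6 for `g` and the quadratic twist
  `g' = g ⊗ χ_L` imply the Heegner main Conj[.] 9.15 for `g` over `L`, that is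
  `ξ(H¹_ord/Λ^ac·κ_g) · ξ(H¹_ord/Λ^ac·κ_g^ι) = ξ(X(g)_tor)`."
* **Thm. 12.9** (label `HMC_r`, tex l.8318): "Let `g ∈ S₂(Γ₀(N))` be an elliptic newform … `p ∤ 2N` …
  Suppose • `λ ∤ a_p(g)`, • `ρ` satisfies (irr_ℚ), (ram) and (sur). Let `L` be an imaginary quadratic
  field satisfying (ord), (coprime), (Heeg) and (irr_L). Then Heeg[n]er main Conj[.] 9.15 for `g`
  over `L` is true." (Proof: (HMC_ub) by Thm. 9.26 [Howard; CGS25 Thm. 6.5.1 rational], then Prop. 12.7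
  and Thm. 9.21 (c). Closing remark p. 98: "The use of two-variable zeta element bypasses the auxiliary
  level raising" — in particular `p` may divide the Tamagawa numbers.)
* **Prop. 12.10** (label `pcv-prop`, tex l.8340): same hypotheses as Prop. 12.7 (non-CM, `λ ∤ a_p`,
  (van_ℚ); `L` with (ord), (coprime), (Heeg), (van_L) and (HMC_ub)). "Then the `λ`-adic Kato's main
  Conj[.] 9.6 for `g` and the quadratic twist `g' = g ⊗ χ_L` imply the p-converse over `L`:
  `corank_{𝒪_λ} Sel_{λ^∞}(A_{g/L}) = 1 ⟹ ord_{s=1} L(s, A_{g/L}) = [F:ℚ]`."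
* Statement 9.15 (label `HMC`, p. 81, tex l.6988), Perrin-Riou: "(a) The Heegner class `κ_g ∈ H¹_ord(L,
  T_g ⊗ Λ^ac)` is `Λ^ac`-non-torsion. Moreover, `rank_{Λ^ac} H¹_ord(L, T_g ⊗ Λ^ac) = rank_{Λ^ac} X^ac(g/L)
  = 1`. (b) `ξ(H¹_ord/Λ^ac·κ_g) · ξ(H¹_ord/Λ^ac·κ_g^ι) = ξ(X(g)_tor)`."
  Hypothesis labels: (ord) = (2.15) `p` splits in `L`; (coprime) = (9.9) `(D_L, N) = 1`; (Heeg);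
  (van_M) `T̄^{G_M} = 0`; (irr_K) absolute irreducibility over `K`; (ram) `∃ ℓ ∥ N`, `ρ̄` ramified at `ℓ`;
  (sur) "the image of `ρ : G_ℚ → GL₂(𝒪_λ)` equals the subgroup of matrices with determinant in `ℤ_p^×`"
  (Thm. 9.26, p. 86) — for an elliptic curve: `ρ_{E,p^∞}` onto `GL₂(ℤ_p)`.

## Transcription (E-instances `A_g = E`, `λ = p`; ORDINARY `p ∤ a_p`)

`W` a globally minimal model of `E`, `N = W.conductorNorm ℤ` the level of the Heegner family;
`K = L` imaginary quadratic, `κ` its ANTICYCLOTOMIC `ℤ_p`-extension with topological generator `γ`,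
`jbar : K̄ → ℂ` (the datum of `HeegnerFamily`). The Heegner main conj. 9.15 for `(E, K, p)` ↦ for every
`Λ`-adic Selmer datum `D`, Heegner family `F` and dual datum `X`: `𝔖 = D.S` and `X.X` finitely
generated of `Λ`-rank one and `char_Λ(X_{tors}) = char_Λ(𝔖/𝐇)²` (`heegnerCharIdeal D F ^ 2`) — the
conclusion shape of `CastellaGrossiSkinner2025.thmC_…`; (HMC_ub) ↦ the divisibility
`char_Λ(X_{tors}) ∣ heegnerCharIdeal D F ^ 2` (third clause of `Howard2004_thmB`). READING NOTE
`BSTW-915-square`: the source writes `ξ(·/Λκ_g)·ξ(·/Λκ_g^ι)` where the tree (Howard, CGS, BCK) writes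
the square `char(𝔖/𝐇)²` — the Heegner module `𝐇 ⊆ 𝔖` is stable under the `ι`-semilinear action of
complex conjugation (Howard 2004 §3.3; Perrin-Riou 1987 §3.4), so `char(𝔖/𝐇)^ι = char(𝔖/𝐇)` and the
two agree; the tree's standing hypothesis `p ∤ h_K` of the Heegner-family vocabulary (Howard Thm.
3.3.7: `𝐇 = Λκ̃₁`) is carried as an EXTRA binder (special case of print; WEAKER, never stronger).
Other dictionary items as in the sibling files: (van_ℚ) ↦ `p ∤ #E(ℚ)_tors`; (van_L) ↦ additionally
`p ∤ #E^{(d_K)}(ℚ)_tors` for a globally minimal model `W'` of the twist by `d_K` (odd `p`); (ord) ↦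
`#primesOver p = 2`; (coprime) ↦ `IsCoprime d_K N`; (Heeg) ↦ `SatisfiesHeegnerHypothesis N K`;
"non-CM" ↦ `¬ W.HasCM`; the two main-conj. hypotheses ↦ `CharIdealEqPadicLFunctionNeron W p`,
`… W' p`; (irr_ℚ) ∧ (irr_L) ∧ (sur) ⟸ `ρ_{E,p^n}` onto for all `n` (`Surj`-type binder
`∀ n, W.HasSurjectiveModNGaloisRep (p ^ n)`; for `p` odd `SL₂(𝔽_p) ⊆ ρ̄(G_L)` is absolutely irreducible —
sufficient conditions, WEAKER than print where (irr_L) alone is printed); (ram) ↦ `Ram W p`; the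
`p`-converse over `L` ↦ `(W.baseChange K).selmerCorank p = 1 → LDerivEK W K ≠ 0` (`ord_{s=1} L(s,E/K) = 1`:
under (Heeg) the sign is `−1`, so "`= 1`" is "`L'(E/K,1) ≠ 0`").

WEAKER-OR-EQUAL to print in every binder (extra `p ∤ h_K`; surjectivity for (irr); reading flags
`BSTW-1111-lattice`, `BSTW-915-square`); never stronger. WHAT IS NOT HERE: the supersingular analogues
(none printed in §12.2); Thm. 12.11 (`p`-converse II) = Thm. 1.10, already the tree's
`burungaleSkinnerTianWan_analyticRank_eq_one_of_selmerCorank_eq_one` (`BSDSelmer.lean`); Prop. 12.1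
((inj)-criterion) and Thm. 12.3 / Cor. 12.5 (g0's `ApplicationsPartIIOPEN.lean`); Thm. 9.26 (Howard +
CGS25 Thm. 6.5.1/6.5.2: PUBLISHED results of other papers — the integral half is the tree's
`Howard2004_thmB`, the rational half is the littype-02 hand-off "CGS25 Thm. 6.5.2").

CONSUMERS: Yan–Zhu 2026 Thm. 5.7 (2) / littype-04's OPEN-QUESTIONS-04 Q3 ("integral anticyclotomic
main conj.s under (Im) rest on BSTW Prop. 12.7", PREPRINT-INPUT); the `p`-converse binder
`BSDSelmerPConverse.lean` (cites "Prop. 12.10 with Thm. 12.9 and Thm. 9.21 (c)"); K2/HPMC lanes at good `p`.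

## References
* [BurungaleSkinnerTianWan2024] arXiv:2409.01350v2: Prop. 12.7 (pp. 97–98; label HMC-prop, tex l.8214,
  display (HMC_ub) l.8225), Thm. 12.9 (p. 98; HMC_r, l.8318), Prop. 12.10 (p. 98; pcv-prop, l.8340),
  statement 9.15 (p. 81; HMC, l.6988), Thm. 9.26 with (sur) (p. 86), Lemma 9.16 (p. 82).
* [Howard2004HeegnerKolyvagin] Thm. B, Thm. 3.3.7; [PerrinRiou1987BSMF] §3.4 — the currency.
* [CastellaGrossiSkinner2025] Theorem C (the equality shape reused); [BurungaleCastellaKim2021] Thm. 3.1.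
-/

noncomputable section

open scoped Classical

open WeierstrassCurve NumberField Literature.NumberTheory.EllipticCurves
  Literature.NumberTheory.EllipticCurves.Rank1Residual

universe u

namespace Literature.NumberTheory.EllipticCurves.BurungaleSkinnerTianWan2024

/-- **OPEN HYPOTHESIS — UNREFEREED PREPRINT (arXiv:2409.01350v2), Prop. 12.7 (pp. 97–98), for an
elliptic curve.** "Let `g = f_E` be non-CM, `p ∤ 2N`, `p ∤ a_p`, (van_ℚ). Let `L` be an imaginary
quadratic field satisfying (ord), (coprime), (Heeg) and (van_L) such that (HMC_ub) holds. Then Kato's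
main conj[.] 9.6 for `g` and `g' = g ⊗ χ_L` imply the Heegner main conj[.] 9.15 for `g` over `L`."
Transcribed (module docstring): `W` globally minimal, `¬ W.HasCM`, `p ≠ 2`, good at `p`, `p ∤ a_p`,
`p ∤ #E(ℚ)_tors`; `K` imaginary quadratic, `p` split, `(d_K, N) = 1`, Heegner hypothesis for
`N = N_E`; `W'` a globally minimal model of `E^{(d_K)}` with `p ∤ #E^{(d_K)}(ℚ)_tors`; `κ`
anticyclotomic with topological generator `γ`; EXTRA `p ∤ h_K` (tree vocabulary); (HMC_ub) as
`char_Λ(X_tors) ∣ char_Λ(𝔖/𝐇)²` for all data; the two cyclotomic statements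
`CharIdealEqPadicLFunctionNeron W p`, `… W' p` ⇒ for all data `(D, F, X)`: `𝔖`, `X` of `Λ`-rank one
and `char_Λ(X_tors) = char_Λ(𝔖/𝐇)²`. NEVER cite this `Prop` as a theorem.
[claim: BurungaleSkinnerTianWan2024, status: under-review]
[cite: BurungaleSkinnerTianWan2024, Prop. 12.7 with (HMC_ub) (pp. 97–98; label HMC-prop, tex l.8214–8232) and statement 9.15 (p. 81) (ANNOUNCED, OPEN binder)] -/
def prop127_heegnerMain_of_mainStatements_OPEN : Prop :=
  ∀ (W W' : WeierstrassCurve ℚ) [W.IsElliptic] [W.IsGloballyMinimal] [NeZero (W.conductorNorm ℤ)]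
    [W'.IsElliptic] [W'.IsGloballyMinimal] (K : Type u) [Field K] [NumberField K]
    (p : ℕ) [Fact p.Prime] (κ : ZpExtension K p) (γ : Field.absoluteGaloisGroup K)
    (jbar : AlgebraicClosure K →+* ℂ) (C : VariableChange ℚ),
    -- `g = f_E` non-CM; `p ∤ 2N` ordinary; (van_ℚ)
    ¬ W.HasCM → p ≠ 2 → W.HasGoodReductionAtPrime p → ¬ (p : ℤ) ∣ W.frobeniusTrace p →
    ¬ p ∣ W.torsionOrder →
    -- `L = K`: imaginary quadratic, (ord), (coprime), (Heeg); EXTRA `p ∤ h_K` (tree currency)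
    IsImaginaryQuadratic K →
    ((Ideal.span {(p : ℤ)}).primesOver (𝓞 K)).ncard = 2 →
    IsCoprime (NumberField.discr K) (W.conductorNorm ℤ) →
    SatisfiesHeegnerHypothesis (W.conductorNorm ℤ) K →
    ¬ p ∣ NumberField.classNumber K →
    -- `g' = g ⊗ χ_L`: model `W'` of the twist by `d_K`; (van_L)
    C • W' = W.quadraticTwist (NumberField.discr K : ℚ) → ¬ p ∣ W'.torsionOrder →
    -- the anticyclotomic tower
    κ.IsAnticyclotomic → κ.IsTopGenerator γ →
    -- (HMC_ub): the Howard-type divisibility, for all data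
    (∀ (D : (W.baseChange K).LambdaAdicSelmerData κ γ)
        (F : HeegnerFamily (W.conductorNorm ℤ) W K κ jbar) (X : (W.baseChange K).SelmerDualData κ γ),
        Module.charIdeal (IwasawaAlgebra p) (Submodule.torsion (IwasawaAlgebra p) X.X) ∣
          heegnerCharIdeal D F ^ 2) →
    -- Kato's main conj. (9.3 (b) form, integral, Néron) for `E` and for `E ⊗ χ_L`
    CharIdealEqPadicLFunctionNeron W p → CharIdealEqPadicLFunctionNeron W' p →
    -- the Heegner main conj. 9.15 for `E` over `K`
    ∀ (D : (W.baseChange K).LambdaAdicSelmerData κ γ)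
      (F : HeegnerFamily (W.conductorNorm ℤ) W K κ jbar) (X : (W.baseChange K).SelmerDualData κ γ),
      (Module.Finite (IwasawaAlgebra p) D.S ∧ Module.finrank (IwasawaAlgebra p) D.S = 1) ∧
      (Module.Finite (IwasawaAlgebra p) X.X ∧ Module.finrank (IwasawaAlgebra p) X.X = 1 ∧
        Module.charIdeal (IwasawaAlgebra p) (Submodule.torsion (IwasawaAlgebra p) X.X) =
          heegnerCharIdeal D F ^ 2)

/-- **OPEN HYPOTHESIS — UNREFEREED PREPRINT (arXiv:2409.01350v2), Thm. 12.9 (p. 98), for an elliptic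
curve: Perrin-Riou's Heegner main conj[.] at an ordinary prime under (irr_ℚ), (ram), (sur) — `p`
allowed to divide the Tamagawa numbers and `h_K`** ("the use of two-variable zeta element bypasses the
auxiliary level raising"). "Let `p ∤ 2N`, `p ∤ a_p`, `ρ` satisfying (irr_ℚ), (ram) and (sur). Let `L`
be an imaginary quadratic field satisfying (ord), (coprime), (Heeg) and (irr_L). Then Heeg[n]er main
conj[.] 9.15 for `g = f_E` over `L` is true." Transcribed: `W` globally minimal, `p ≠ 2`, good, `p ∤ a_p`;
(irr_ℚ) ∧ (irr_L) ∧ (sur) ⟸ `ρ_{E,p^n}` onto for every `n` (WEAKER than print for (irr_L)); (ram) =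
`Ram W p`; `K` imaginary quadratic, `p` split, `(d_K, N) = 1`, Heegner hypothesis; EXTRA `p ∤ h_K`
(tree currency); `κ` anticyclotomic, `γ` a topological generator ⇒ for all data `(D, F, X)` the
statement 9.15 shape (`𝔖`, `X` of rank one, `char_Λ(X_tors) = char_Λ(𝔖/𝐇)²`). NEVER cite this `Prop`
as a theorem. [claim: BurungaleSkinnerTianWan2024, status: under-review]
[cite: BurungaleSkinnerTianWan2024, Thm. 12.9 (p. 98; label HMC_r, tex l.8318) with (sur) of Thm. 9.26 (p. 86) (ANNOUNCED, OPEN binder)] -/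
def thm129_heegnerMain_OPEN : Prop :=
  ∀ (W : WeierstrassCurve ℚ) [W.IsElliptic] [W.IsGloballyMinimal] [NeZero (W.conductorNorm ℤ)]
    (K : Type u) [Field K] [NumberField K] (p : ℕ) [Fact p.Prime] (κ : ZpExtension K p)
    (γ : Field.absoluteGaloisGroup K) (jbar : AlgebraicClosure K →+* ℂ),
    -- `p ∤ 2N` ordinary; (irr_ℚ), (irr_L), (sur) via `p`-adic surjectivity; (ram)
    p ≠ 2 → W.HasGoodReductionAtPrime p → ¬ (p : ℤ) ∣ W.frobeniusTrace p →
    (∀ n : ℕ, W.HasSurjectiveModNGaloisRep ((p : ℤ) ^ n)) → Ram W p →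
    -- `L = K`: imaginary quadratic, (ord), (coprime), (Heeg); EXTRA `p ∤ h_K`
    IsImaginaryQuadratic K →
    ((Ideal.span {(p : ℤ)}).primesOver (𝓞 K)).ncard = 2 →
    IsCoprime (NumberField.discr K) (W.conductorNorm ℤ) →
    SatisfiesHeegnerHypothesis (W.conductorNorm ℤ) K →
    ¬ p ∣ NumberField.classNumber K →
    κ.IsAnticyclotomic → κ.IsTopGenerator γ →
    ∀ (D : (W.baseChange K).LambdaAdicSelmerData κ γ)
      (F : HeegnerFamily (W.conductorNorm ℤ) W K κ jbar) (X : (W.baseChange K).SelmerDualData κ γ),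
      (Module.Finite (IwasawaAlgebra p) D.S ∧ Module.finrank (IwasawaAlgebra p) D.S = 1) ∧
      (Module.Finite (IwasawaAlgebra p) X.X ∧ Module.finrank (IwasawaAlgebra p) X.X = 1 ∧
        Module.charIdeal (IwasawaAlgebra p) (Submodule.torsion (IwasawaAlgebra p) X.X) =
          heegnerCharIdeal D F ^ 2)

/-- **Burungale–Skinner–Tian–Wan 2024, Thm. 12.9 (HMC_r) for an elliptic curve — PINNED to a minimal-degree parametrisation with `p`-ADIC-UNIT MANIN CONSTANT** (BSD cited-literature audit ARM P, REGISTER R-15 / TY-QUEUE 25; reader bsd-cited-r19 sheets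
`D-AUDIT-r19-ADDENDUM-5.md` sha16 6a0e68f1a5f0faa2 §4, ADDENDUM-6 c1c6b9e51d6d0dd9 and ADDENDUM-8
24e75636994fcc95 (v2) §4 (the Manin pin, rider R-b of r17 ADDENDUM-4 0434952c634f1c51); typer bsd-cited-ty4 g7/g8/g10,
2026-08-27; lead rulings (181)/(198)/(243) + RULING (316) «TYQ 25: kit v5.2 is the release shape»): the statement of
`thm129_heegnerMain_OPEN` (kept byte-identical above) with TWO extra hypotheses as binders right after `F`:
(F1) `∀ Dt', F.Dt.deg ≤ Dt'.deg` — minimal modular degree among the data of the same curve and level (`φ = ±φ_min`) =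
VERBATIM the body of `ModularForms.ModularParametrizationData.IsMinimal F.Dt` (`ModularParametrizationScalingProofs.lean`,
p482958: `exists_isMinimal`, `IsMinimal.deg_eq`, `not_isMinimal_zsmul`), spelled out because that module lies DOWNSTREAM of
this file (an `import` would close a cycle); the two agree by `Iff.rfl` — kernel lemma `TYQ25Check.pin_iff_isMinimal_conductorLevel`
of the kit file `run/shared/lean/pub/bsd-cited/staging/bsd-cited-ty4/TYQ25-kit/check/K_TYQ25_pin_iff_isMinimal.lean` sha16
3e421a28abe396fd (imports both modules; farm rc 0, axioms trio; lead (243)).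
(F1′, the MANIN PIN) `¬ (p : ℤ) ∣ F.Dt.c` — the Manin constant of `φ` (`φ^*ω_W = c · 2πi f dτ`) is a `p`-adic unit:
Perrin-Riou's Conj. B carries the factor `c_π · (#𝒪_K^× / 2)` [PR87 §1 p. 405; BCK21 Rem. after Conj. 1], which the `c`-free
form printed here drops exactly when it is a `p`-adic unit (Mazur 1978 Cor. 4.1 for the OPTIMAL curve; NOT automatic for a
non-optimal curve at an Eisenstein `p` — PR87 p. 409 Ex. 3, `X_0(11)/μ_5` at `p = 5`); inside the pin the statement does
not depend on the parametrisation (r19 ADD-8 kernel `sheets/r19-add8/d_audit_r19_add8_manin_pin_check.lean` f8a7d8f730b7607f,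
K2 `nonsplitClause_iff_zsmul` / `charIdeal_quot_span_C_smul_eq_of_not_dvd`, K3 shapes `…ManinPinned`; TREE theorems
`heegnerCharIdeal_zsmul_of_not_dvd` / `heegnerModule_zsmul_of_not_dvd` / `charIdeal_quotient_span_C_smul_eq_of_not_dvd` of
`HeegnerModuleScalingProofs.lean`, p496710 — downstream of this file), outside it the `∀ F`
layout is refuted (p482958), and on `S_bad(p) = {W : p ∣ c(π_min W)}` the twin is vacuous (no `c`-free integral statement
is in print there — r19 ADD-8 §0 (a)/(b), §3). WHY: print works with ONE fixed parametrisation (the Heegner classes of the fixed parametrisation of §12, in the layout of [CGS25]/[How04]), whereas `∀ (F : HeegnerFamily …)` ranges over every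
rescaling `[m] ∘ φ` of it (`F.Dt.c ↦ m · F.Dt.c`; points and `Λ`-adic class scale by `m` — kernel theorems
`HeegnerFamily.zsmul` / `KellerYin2024.false_of_thm521_OPEN_zsmul` (p481261), `HeegnerFamily.zsmulSelf` /
`false_of_thm521_OPEN_of_witness` (p482958)), and an INTEGRAL equality of characteristic ideals cannot hold for a class
and its `p`-multiple at once (`char_Λ(𝔖/Λpz) = (p) · char_Λ(𝔖/Λz)`): the unpinned binder above is STRONGER than print, this
pinned one is print's statement (reader's verdict word VERBATIM-SPECIALISED; flag `HPMC-Manin-normalisation`, priced by the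
desks). The bridge `thm129_heegnerMain_minimal_OPEN_of_unpinned` (unpinned ⇒ pinned) is PROVED, so nothing is asserted beyond the declaration above;
divisibility-shaped binders are unaffected (r19 ADD-5 §4.3).
NEVER cite this `Prop` as a theorem: take it as an explicit hypothesis; a result using it is conditional on
an announced, unrefereed preprint.
[claim: BurungaleSkinnerTianWan2024, status: under-review]
[cite: BurungaleSkinnerTianWan2024, Thm. 12.9 (p. 98; label HMC_r, tex l.8318) with (sur) of Thm. 9.26 (p. 86) (ANNOUNCED, OPEN binder)]
[cite: PerrinRiou1987BSMF, §1 Conj. B p. 405 (the factor c_π · u)] [cite: BurungaleCastellaKim2021, Remark after Conj. 1 (the factor c_π · #𝒪_K^× / 2; Mazur for p ∤ N)] -/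
def thm129_heegnerMain_minimal_OPEN : Prop :=
  ∀ (W : WeierstrassCurve ℚ) [W.IsElliptic] [W.IsGloballyMinimal] [NeZero (W.conductorNorm ℤ)]
    (K : Type u) [Field K] [NumberField K] (p : ℕ) [Fact p.Prime] (κ : ZpExtension K p)
    (γ : Field.absoluteGaloisGroup K) (jbar : AlgebraicClosure K →+* ℂ),
    -- `p ∤ 2N` ordinary; (irr_ℚ), (irr_L), (sur) via `p`-adic surjectivity; (ram)
    p ≠ 2 → W.HasGoodReductionAtPrime p → ¬ (p : ℤ) ∣ W.frobeniusTrace p →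
    (∀ n : ℕ, W.HasSurjectiveModNGaloisRep ((p : ℤ) ^ n)) → Ram W p →
    -- `L = K`: imaginary quadratic, (ord), (coprime), (Heeg); EXTRA `p ∤ h_K`
    IsImaginaryQuadratic K →
    ((Ideal.span {(p : ℤ)}).primesOver (𝓞 K)).ncard = 2 →
    IsCoprime (NumberField.discr K) (W.conductorNorm ℤ) →
    SatisfiesHeegnerHypothesis (W.conductorNorm ℤ) K →
    ¬ p ∣ NumberField.classNumber K →
    κ.IsAnticyclotomic → κ.IsTopGenerator γ →
    ∀ (D : (W.baseChange K).LambdaAdicSelmerData κ γ)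
      (F : HeegnerFamily (W.conductorNorm ℤ) W K κ jbar)
      -- PINNED (fix F1): `F.Dt` has minimal modular degree (`φ = ±φ_min`) — verbatim the body of
      -- `ModularForms.ModularParametrizationData.IsMinimal F.Dt` (`ModularParametrizationScalingProofs.lean`)
      (_ : ∀ Dt' : ModularForms.ModularParametrizationData W (W.conductorNorm ℤ), F.Dt.deg ≤ Dt'.deg)
      -- PINNED (fix F1′, the Manin pin — rider R-b): the parametrisation's Manin constant is a `p`-adic unit
      (_ : ¬ (p : ℤ) ∣ F.Dt.c)
      (X : (W.baseChange K).SelmerDualData κ γ),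
      (Module.Finite (IwasawaAlgebra p) D.S ∧ Module.finrank (IwasawaAlgebra p) D.S = 1) ∧
      (Module.Finite (IwasawaAlgebra p) X.X ∧ Module.finrank (IwasawaAlgebra p) X.X = 1 ∧
        Module.charIdeal (IwasawaAlgebra p) (Submodule.torsion (IwasawaAlgebra p) X.X) =
          heegnerCharIdeal D F ^ 2)

/-- **Bridge, PROVED**: the unpinned `thm129_heegnerMain_OPEN` implies its pinned twin (the two extra
hypotheses are discarded) — so the twin is a WEAKENING, never a strengthening. [claim: BurungaleSkinnerTianWan2024, status: under-review] -/
theorem thm129_heegnerMain_minimal_OPEN_of_unpinned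
    (h : thm129_heegnerMain_OPEN.{u}) :
    thm129_heegnerMain_minimal_OPEN.{u} :=
  fun W _ _ _ K _ _ p _ κ γ jbar h2 hg ho hs hr hK hsp hc hH hh ha ht D F _ _ X ↦
    h W K p κ γ jbar h2 hg ho hs hr hK hsp hc hH hh ha ht D F X


/-- **OPEN HYPOTHESIS — UNREFEREED PREPRINT (arXiv:2409.01350v2), Prop. 12.10 (p. 98), for an elliptic
curve: the `p`-converse over `L` from Kato's main conj[.] for `g`, `g'` and (HMC_ub).** Same hypotheses
as Prop. 12.7 (non-CM, `p ∤ 2N`, `p ∤ a_p`, (van_ℚ); `L` with (ord), (coprime), (Heeg), (van_L),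
(HMC_ub)); "Then the `λ`-adic Kato's main Conj[.] 9.6 for `g` and the quadratic twist `g' = g ⊗ χ_L`
imply the p-converse over `L`: `corank_{ℤ_p} Sel_{p^∞}(E/L) = 1 ⟹ ord_{s=1} L(s, E/L) = 1`."
Transcribed as for `prop127_heegnerMain_of_mainStatements_OPEN`, conclusion
`(W.baseChange K).selmerCorank p = 1 → LDerivEK W K ≠ 0`. NEVER cite this `Prop` as a theorem.
[claim: BurungaleSkinnerTianWan2024, status: under-review]
[cite: BurungaleSkinnerTianWan2024, Prop. 12.10 (p. 98; label pcv-prop, tex l.8340) (ANNOUNCED, OPEN binder)] -/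
def prop1210_pConverseOverL_of_mainStatements_OPEN : Prop :=
  ∀ (W W' : WeierstrassCurve ℚ) [W.IsElliptic] [W.IsGloballyMinimal] [NeZero (W.conductorNorm ℤ)]
    [W'.IsElliptic] [W'.IsGloballyMinimal] (K : Type u) [Field K] [NumberField K]
    (p : ℕ) [Fact p.Prime] (κ : ZpExtension K p) (γ : Field.absoluteGaloisGroup K)
    (jbar : AlgebraicClosure K →+* ℂ) (C : VariableChange ℚ),
    ¬ W.HasCM → p ≠ 2 → W.HasGoodReductionAtPrime p → ¬ (p : ℤ) ∣ W.frobeniusTrace p →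
    ¬ p ∣ W.torsionOrder →
    IsImaginaryQuadratic K →
    ((Ideal.span {(p : ℤ)}).primesOver (𝓞 K)).ncard = 2 →
    IsCoprime (NumberField.discr K) (W.conductorNorm ℤ) →
    SatisfiesHeegnerHypothesis (W.conductorNorm ℤ) K →
    ¬ p ∣ NumberField.classNumber K →
    C • W' = W.quadraticTwist (NumberField.discr K : ℚ) → ¬ p ∣ W'.torsionOrder →
    κ.IsAnticyclotomic → κ.IsTopGenerator γ →
    (∀ (D : (W.baseChange K).LambdaAdicSelmerData κ γ)
        (F : HeegnerFamily (W.conductorNorm ℤ) W K κ jbar) (X : (W.baseChange K).SelmerDualData κ γ),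
        Module.charIdeal (IwasawaAlgebra p) (Submodule.torsion (IwasawaAlgebra p) X.X) ∣
          heegnerCharIdeal D F ^ 2) →
    CharIdealEqPadicLFunctionNeron W p → CharIdealEqPadicLFunctionNeron W' p →
    ((W.baseChange K).selmerCorank p = 1 → LDerivEK W K ≠ 0)

/-! ### Bookkeeping between the binders and the tree's published shapes -/

/-- Granted the Thm. 12.9 binder, its conclusion contains the divisibility `char_Λ(X_tors) ∣ char_Λ(𝔖/𝐇)²`
— the third clause of the tree's PUBLISHED `Howard2004_thmB` — at data where (sur)+(ram) replace
Howard's `d_K ≠ −3, −4` / BCK's `p ≥ 5`: sanity that the OPEN binder and the published facts share one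
currency. Between binders; asserts nothing. [claim: BurungaleSkinnerTianWan2024, status: under-review]
[cite: Howard2004HeegnerKolyvagin, §1 Thm. B (c) (shape)] -/
theorem charIdeal_torsion_dvd_of_thm129_OPEN (h : thm129_heegnerMain_OPEN.{u})
    (W : WeierstrassCurve ℚ) [W.IsElliptic] [W.IsGloballyMinimal] [NeZero (W.conductorNorm ℤ)]
    (K : Type u) [Field K] [NumberField K] (p : ℕ) [Fact p.Prime] (κ : ZpExtension K p)
    (γ : Field.absoluteGaloisGroup K) (jbar : AlgebraicClosure K →+* ℂ)
    (hp2 : p ≠ 2) (hgood : W.HasGoodReductionAtPrime p) (hord : ¬ (p : ℤ) ∣ W.frobeniusTrace p)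
    (hsur : ∀ n : ℕ, W.HasSurjectiveModNGaloisRep ((p : ℤ) ^ n)) (hram : Ram W p)
    (hK : IsImaginaryQuadratic K) (hsplit : ((Ideal.span {(p : ℤ)}).primesOver (𝓞 K)).ncard = 2)
    (hcop : IsCoprime (NumberField.discr K) (W.conductorNorm ℤ))
    (hH : SatisfiesHeegnerHypothesis (W.conductorNorm ℤ) K) (hh : ¬ p ∣ NumberField.classNumber K)
    (hκ : κ.IsAnticyclotomic) (hγ : κ.IsTopGenerator γ)
    (D : (W.baseChange K).LambdaAdicSelmerData κ γ) (F : HeegnerFamily (W.conductorNorm ℤ) W K κ jbar)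
    (X : (W.baseChange K).SelmerDualData κ γ) :
    Module.charIdeal (IwasawaAlgebra p) (Submodule.torsion (IwasawaAlgebra p) X.X) ∣
      heegnerCharIdeal D F ^ 2 :=
  dvd_of_eq (h W K p κ γ jbar hp2 hgood hord hsur hram hK hsplit hcop hH hh hκ hγ D F X).2.2.2

/-- Granted BOTH the Prop. 12.7 binder and the Thm. 12.9-type divisibility (HMC_ub) at the data, the
two cyclotomic statements for `E` and `E ⊗ χ_L` yield the "lower bound" half
`char_Λ(𝔖/𝐇)² ∣ char_Λ(X_tors)` — the half no Kolyvagin-system argument gives (cf.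
`CastellaGrossiSkinner2025.heegnerCharIdeal_sq_dvd_of_thmC`). Between binders; asserts nothing.
[claim: BurungaleSkinnerTianWan2024, status: under-review]
[cite: BurungaleSkinnerTianWan2024, Prop. 12.7 (pp. 97–98; OPEN binder)] -/
theorem heegnerCharIdeal_sq_dvd_of_prop127_OPEN (h : prop127_heegnerMain_of_mainStatements_OPEN.{u})
    (W W' : WeierstrassCurve ℚ) [W.IsElliptic] [W.IsGloballyMinimal] [NeZero (W.conductorNorm ℤ)]
    [W'.IsElliptic] [W'.IsGloballyMinimal] (K : Type u) [Field K] [NumberField K]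
    (p : ℕ) [Fact p.Prime] (κ : ZpExtension K p) (γ : Field.absoluteGaloisGroup K)
    (jbar : AlgebraicClosure K →+* ℂ) {C : VariableChange ℚ}
    (hcm : ¬ W.HasCM) (hp2 : p ≠ 2) (hgood : W.HasGoodReductionAtPrime p)
    (hord : ¬ (p : ℤ) ∣ W.frobeniusTrace p) (hvan : ¬ p ∣ W.torsionOrder)
    (hK : IsImaginaryQuadratic K) (hsplit : ((Ideal.span {(p : ℤ)}).primesOver (𝓞 K)).ncard = 2)
    (hcop : IsCoprime (NumberField.discr K) (W.conductorNorm ℤ))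
    (hH : SatisfiesHeegnerHypothesis (W.conductorNorm ℤ) K) (hh : ¬ p ∣ NumberField.classNumber K)
    (hC : C • W' = W.quadraticTwist (NumberField.discr K : ℚ)) (hvan' : ¬ p ∣ W'.torsionOrder)
    (hκ : κ.IsAnticyclotomic) (hγ : κ.IsTopGenerator γ)
    (hub : ∀ (D : (W.baseChange K).LambdaAdicSelmerData κ γ)
        (F : HeegnerFamily (W.conductorNorm ℤ) W K κ jbar) (X : (W.baseChange K).SelmerDualData κ γ),
        Module.charIdeal (IwasawaAlgebra p) (Submodule.torsion (IwasawaAlgebra p) X.X) ∣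
          heegnerCharIdeal D F ^ 2)
    (hMC : CharIdealEqPadicLFunctionNeron W p) (hMC' : CharIdealEqPadicLFunctionNeron W' p)
    (D : (W.baseChange K).LambdaAdicSelmerData κ γ) (F : HeegnerFamily (W.conductorNorm ℤ) W K κ jbar)
    (X : (W.baseChange K).SelmerDualData κ γ) :
    heegnerCharIdeal D F ^ 2 ∣
      Module.charIdeal (IwasawaAlgebra p) (Submodule.torsion (IwasawaAlgebra p) X.X) :=
  dvd_of_eq (h W W' K p κ γ jbar C hcm hp2 hgood hord hvan hK hsplit hcop hH hh hC hvan' hκ hγ hub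
    hMC hMC' D F X).2.2.2.symm

end Literature.NumberTheory.EllipticCurves.BurungaleSkinnerTianWan2024

end
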